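import Mathlib
import HarnessLib
import Literature.LinearAlgebra.Matrix.CauchyDeterminant

/-!
# Cauchy-like matrices (scaled-Cauchy generator form)

Topic `LinearAlgebra/Matrix`. A matrix `A` over a field is *Cauchy-like* with respect to the node
vectors `x : m → K`, `y : n → K` (all `x i ≠ y j`) when its Sylvester displacement
`diag(x) · A − A · diag(y)` has small rank `α`; writing that displacement as `G · Hᵀ` with
`G : m × α`, `H : n × α` (a *generator* of `A`), the matrix is recovered entrywise as
`A i j = (G Hᵀ) i j / (x i − y j)` (Heinig–Rost 1984; Gohberg–Kailath–Olshevsky 1995, §1;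
Pan 2001, §1.3–1.5). This file fixes that generator form as a definition and proves the four
one-line facts every structured-elimination argument starts from:

* `cauchyLike x y G H` — the matrix `((G * Hᵀ) i j / (x i - y j))_{i,j}` (generator index type
  `p` arbitrary finite);
* `diagonal_mul_cauchyLike_sub` — it satisfies the displacement equation when the node sets are
  disjoint;
* `eq_cauchyLike_of_displacement` — conversely the displacement equation with disjoint nodes
  determines the matrix (the Sylvester operator `A ↦ D_x A − A D_y` is invertible, entrywise);
* `cauchyLike_submatrix`, `cauchyLike_transpose` — sub-blocks and the transpose are Cauchy-like
  with the restricted / swapped data (the transpose picks up a sign in one generator).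

The plain Cauchy matrix `(1/(x_i - y_j))` of `CauchyDeterminant.lean` (`cauchyMatrix`, nodes
indexed by `ℕ`) is the case of the all-ones rank-one generator; the bridge lemma is
`cauchyLike_one_one`. Deliberately NOT here: the Schur-complement and inverse generator formulas
(GKO 1995, Lemma 1.1) and any algorithm — they live with their users.

## References
* I. Gohberg, T. Kailath, V. Olshevsky, *Fast Gaussian elimination with partial pivoting for
  matrices with displacement structure*, Math. Comp. 64 (1995), §1. [GohbergKailathOlshevsky1995]
* G. Heinig, K. Rost, *Algebraic Methods for Toeplitz-like Matrices and Operators*, 1984. [HeinigRost1984]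
* V. Y. Pan, *Structured Matrices and Polynomials*, Birkhäuser 2001, §1.3–§1.5. [Pan2001]
-/

namespace Literature.LinearAlgebra.Matrix

universe u v w z

open scoped BigOperators
open _root_.Matrix

variable {K : Type u} [Field K]
variable {m : Type v} {n : Type w} {p : Type z} [Fintype p]

/-- The **Cauchy-like matrix** with nodes `x, y` and generator `(G, H)`:
`cauchyLike x y G H i j = (G * Hᵀ) i j / (x i - y j) = (∑ k, G i k * H j k) / (x i - y j)`
(GKO 1995, §1, eq. (1.4) solved entrywise; Pan 2001, §1.4). Meaningful when `x i ≠ y j` for all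
`i, j`; for a coinciding pair the entry is the junk value `_/0 = 0`. [cite: GohbergKailathOlshevsky1995, §1] -/
def cauchyLike (x : m → K) (y : n → K) (G : Matrix m p K) (H : Matrix n p K) : Matrix m n K :=
  Matrix.of fun i j => (G * Hᵀ) i j / (x i - y j)

omit [Fintype p] in
/-- Entries of a Cauchy-like matrix. [cite: GohbergKailathOlshevsky1995, §1] -/
@[simp] theorem cauchyLike_apply [Fintype p] (x : m → K) (y : n → K) (G : Matrix m p K)
    (H : Matrix n p K) (i : m) (j : n) :
    cauchyLike x y G H i j = (∑ k, G i k * H j k) / (x i - y j) := by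
  simp [cauchyLike, Matrix.mul_apply, Matrix.transpose_apply]

/-- **Displacement equation**: with disjoint node sets, `diag(x) · C − C · diag(y) = G · Hᵀ` for
`C = cauchyLike x y G H` (GKO 1995, eq. (1.4); Pan 2001, §1.4). [cite: GohbergKailathOlshevsky1995, §1 eq. (1.4)] -/
theorem diagonal_mul_cauchyLike_sub [Fintype m] [Fintype n] [DecidableEq m] [DecidableEq n]
    (x : m → K) (y : n → K) (G : Matrix m p K) (H : Matrix n p K) (hxy : ∀ i j, x i ≠ y j) :
    Matrix.diagonal x * cauchyLike x y G H - cauchyLike x y G H * Matrix.diagonal y = G * Hᵀ := by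
  ext i j
  have h : x i - y j ≠ 0 := sub_ne_zero.2 (hxy i j)
  simp only [Matrix.sub_apply, Matrix.diagonal_mul, Matrix.mul_diagonal, cauchyLike,
    Matrix.of_apply]
  field_simp

/-- **Reconstruction / uniqueness**: a matrix whose Sylvester displacement w.r.t. disjoint diagonal
operators is `G · Hᵀ` IS the Cauchy-like matrix with generator `(G, H)` — the operator
`A ↦ diag(x) A − A diag(y)` acts entrywise as multiplication by `x i − y j ≠ 0`
(GKO 1995, §1; Pan 2001, Thm. 1.3.1 for diagonal operators). [cite: GohbergKailathOlshevsky1995, §1] -/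
theorem eq_cauchyLike_of_displacement [Fintype m] [Fintype n] [DecidableEq m] [DecidableEq n]
    {x : m → K} {y : n → K} {A : Matrix m n K} {G : Matrix m p K} {H : Matrix n p K}
    (hxy : ∀ i j, x i ≠ y j) (hA : Matrix.diagonal x * A - A * Matrix.diagonal y = G * Hᵀ) :
    A = cauchyLike x y G H := by
  ext i j
  have h : x i - y j ≠ 0 := sub_ne_zero.2 (hxy i j)
  have hij := congrFun (congrFun hA i) j
  simp only [Matrix.sub_apply, Matrix.diagonal_mul, Matrix.mul_diagonal] at hij
  simp only [cauchyLike, Matrix.of_apply, ← hij]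
  field_simp

omit [Fintype p] in
/-- **Sub-blocks are Cauchy-like** with the restricted nodes and generator rows
(GKO 1995, §1: "any submatrix of a Cauchy-like matrix is Cauchy-like"). [cite: GohbergKailathOlshevsky1995, §1] -/
theorem cauchyLike_submatrix [Fintype p] {m' : Type*} {n' : Type*} (x : m → K) (y : n → K)
    (G : Matrix m p K) (H : Matrix n p K) (e : m' → m) (f : n' → n) :
    (cauchyLike x y G H).submatrix e f =
      cauchyLike (x ∘ e) (y ∘ f) (G.submatrix e id) (H.submatrix f id) := by
  ext i j
  simp [cauchyLike, Matrix.mul_apply]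

omit [Fintype p] in
/-- **The transpose is Cauchy-like** with swapped nodes and generator `(-H, G)`:
`(x i - y j)⁻¹ = -(y j - x i)⁻¹`. [cite: GohbergKailathOlshevsky1995, §1] -/
theorem cauchyLike_transpose [Fintype p] (x : m → K) (y : n → K) (G : Matrix m p K)
    (H : Matrix n p K) : (cauchyLike x y G H)ᵀ = cauchyLike y x (-H) G := by
  ext j i
  simp only [Matrix.transpose_apply, cauchyLike_apply, Matrix.neg_apply]
  rw [← neg_sub (x i) (y j), div_neg, ← neg_div, ← Finset.sum_neg_distrib]
  congr 1
  exact Finset.sum_congr rfl fun k _ => by ring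

omit [Fintype p] in
/-- Scaling the generator columns: `cauchyLike x y G H` only depends on `G * Hᵀ`. [folklore] -/
theorem cauchyLike_eq_of_mul_transpose_eq [Fintype p] {p' : Type*} [Fintype p'] (x : m → K)
    (y : n → K) {G : Matrix m p K} {H : Matrix n p K} {G' : Matrix m p' K} {H' : Matrix n p' K}
    (h : G * Hᵀ = G' * H'ᵀ) : cauchyLike x y G H = cauchyLike x y G' H' := by
  ext i j
  simp only [cauchyLike, Matrix.of_apply, h]

/-- The plain Cauchy matrix of `CauchyDeterminant.lean` is the Cauchy-like matrix with the all-ones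
rank-one generator (nodes read through `Fin n → ℕ`). [folklore] -/
theorem cauchyLike_one_one (x y : ℕ → K) (N : ℕ) :
    cauchyLike (K := K) (fun i : Fin N => x i) (fun j : Fin N => y j)
      (fun _ (_ : Fin 1) => (1 : K)) (fun _ (_ : Fin 1) => (1 : K)) = cauchyMatrix x y N := by
  ext i j
  simp [cauchyLike, cauchyMatrix, Matrix.mul_apply]

end Literature.LinearAlgebra.Matrix
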